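import Summits.AtomisticToContinuum.Crystallization.Theorems.FrustratedLawDichotomyCoupledCluster
import Summits.AtomisticToContinuum.Crystallization.Theorems.FrustratedLawDichotomyBondGraphWindows

/-!
# FrustratedLawDichotomy · crux `AperiodicFrustratedLawGap` (stmt-AtomisticToContinuum-27623) — THE ℚ-MIRROR OF `M⁺`
# (`CappedRigidityBoth`, the two-shell statement shared with lens-4's RDEF line; critic rows 428 (5), 431 (3)) (decomp-a2c, hand 2, gen 9)

Lens-5 g30's `CappedRigidityBothAt θ η₁ η₂ Pat` (p820618) asks for ONE linear isometry `A` fitting the bonded dozen within `η₁·nn_i` AND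
every cap `m` (every site `≠ i` bonded to the four vertices of a square `{u, v}` of the link) within `η₂·nn_i` of `nn_i·A(u + v)`.  Since
the caps are ALL such sites (not one chosen per square), the finite mirror must carry SET-valued cap data:

`CappedCertBoth θ η₁ η₂ Pat` := for all shells `p : Pat → ℝ³` and cap SETS `C a b ⊆ ℝ³` (`dist a b = √2`; nonempty), on the cluster
`K = {0} ∪ range p ∪ ⋃ C a b` with the clauses of `CoupledCluster` (radial window, injectivity, nd-coupling, coupled contact bonds, non-contact
strictness) and, for EVERY `x ∈ C a b`, the cap clauses (`1 ≤ ‖x‖`, `x ∉ range p`, not bonded to the centre, cap bonds to the four square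
vertices coupled at both ends):  `∃ A`, `‖p u − A u‖ ≤ η₁` for all `u` AND `‖x − A(a + b)‖ ≤ η₂` for all `x ∈ C a b`.

* `cappedRigidityBothAt_of_certBoth` : (contact graph of `Pat` separates points) `→ CappedCertBoth θ η₁ η₂ Pat → CappedRigidityBothAt θ η₁ η₂ Pat`;
* `cappedRigidityBoth_of_certBoth` : both patterns ⟹ `CappedRigidityBoth θ η₁ η₂` (hence FLD's `M` via lens-5's `cappedRigidity_of_both` when
  `η₁ < η`, and lens-4's two-shell reading with `max η₁ η₂`).
ONE certificate over this set (census TAG 157 «D», all 18 points) serves both lines.  `[folklore]` bookkeeping; no `sorry`.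
-/

noncomputable section

namespace Summit.AtomisticToContinuum.Crystallization.Theorems.FrustratedLawDichotomyCappedCertBoth

open Literature.Geometry.DiscreteGeometry
open Summit.AtomisticToContinuum.Crystallization.Theorems.FrustratedLawDichotomyTwoShellRigidityCut (E3 LinkIso Capped)
open Summit.AtomisticToContinuum.Crystallization.Theorems.FrustratedLawDichotomyTwoShellRigidityCells
  (CappedRigidityBothAt CappedRigidityBoth)
open Summit.AtomisticToContinuum.Crystallization.Theorems.FrustratedLawDichotomyCappedRigidityCertPatterns
  (fcc_contactSeparating hcp_contactSeparating)
open Summit.AtomisticToContinuum.Crystallization.Theorems.FrustratedLawDichotomyBondGraphWindows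
  (one_add_pos_of_adj dist_le_mul_dist_of_adj min_dist_lt_dist_of_not_adj)

/-- The cluster of the two-shell finite problem with SET-valued caps: centre, shell, and every cap candidate. [folklore] -/
def capClusterSet {Pat : Finset E3} (p : ↥Pat → E3) (C : ↥Pat → ↥Pat → Set E3) : Set E3 :=
  insert 0 (Set.range p ∪ {x | ∃ a b : ↥Pat, dist (a : E3) (b : E3) = Real.sqrt 2 ∧ x ∈ C a b})

/-- **`CappedCertBoth θ η₁ η₂ Pat` — the ℚ-mirror of `M⁺ = CappedRigidityBothAt θ η₁ η₂ Pat`** (set-valued caps; see the module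
docstring). [certificate target; census TAG 157 «D» (all 18 points)] -/
def CappedCertBoth (θ η₁ η₂ : ℝ) (Pat : Finset E3) : Prop :=
  ∀ (p : ↥Pat → E3) (C : ↥Pat → ↥Pat → Set E3),
    (∀ u : ↥Pat, 1 ≤ ‖p u‖ ∧ ‖p u‖ ≤ 1 + θ) →
    Function.Injective p →
    (∀ u : ↥Pat, ∀ x ∈ capClusterSet p C, x ≠ p u → ‖p u‖ ≤ (1 + θ) * ‖p u - x‖) →
    (∀ u v : ↥Pat, dist (u : E3) (v : E3) = 1 →
      ∀ x ∈ capClusterSet p C, x ≠ p u → ‖p u - p v‖ ≤ (1 + θ) * ‖p u - x‖) →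
    (∀ u v : ↥Pat, u ≠ v → dist (u : E3) (v : E3) ≠ 1 → min ‖p u‖ ‖p v‖ < ‖p u - p v‖) →
    (∀ a b : ↥Pat, dist (a : E3) (b : E3) = Real.sqrt 2 → (C a b).Nonempty ∧ ∀ c ∈ C a b,
      1 ≤ ‖c‖ ∧ (∀ w : ↥Pat, c ≠ p w) ∧
      (∀ w : ↥Pat, (w = a ∨ w = b ∨ (dist (w : E3) (a : E3) = 1 ∧ dist (w : E3) (b : E3) = 1)) →
        min (1 + θ) ‖c - p w‖ < ‖c‖ ∧
        (∀ x ∈ capClusterSet p C, x ≠ c → ‖c - p w‖ ≤ (1 + θ) * ‖c - x‖) ∧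
        (∀ x ∈ capClusterSet p C, x ≠ p w → ‖c - p w‖ ≤ (1 + θ) * ‖p w - x‖))) →
    ∃ A : E3 →ₗᵢ[ℝ] E3, (∀ u : ↥Pat, ‖p u - A (u : E3)‖ ≤ η₁) ∧
      ∀ a b : ↥Pat, dist (a : E3) (b : E3) = Real.sqrt 2 → ∀ c ∈ C a b, ‖c - A ((a : E3) + (b : E3))‖ ≤ η₂

/-- **THE REDUCTION `CappedCertBoth → CappedRigidityBothAt`** (every θ, η₁, η₂; pattern with point-separating contact graph). [folklore] -/
theorem cappedRigidityBothAt_of_certBoth {θ η₁ η₂ : ℝ} {Pat : Finset E3}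
    (hPat : ∀ u v : ↥Pat, u ≠ v → ∃ w : ↥Pat, dist (u : E3) (w : E3) = 1 ∧ dist (v : E3) (w : E3) ≠ 1)
    (hcert : CappedCertBoth θ η₁ η₂ Pat) : CappedRigidityBothAt θ η₁ η₂ Pat := by
  classical
  intro N y i τ hy _hsep hL hC
  rcases isEmpty_or_nonempty ↥Pat with hE | ⟨⟨u₀⟩⟩
  · exact ⟨LinearIsometry.id, fun u => (hE.false u).elim, fun a => (hE.false a).elim⟩
  have hτi : ∀ u, τ u ≠ i := fun u h => (hL.1 u).ne h.symm
  have hθ : 0 ≤ 1 + θ := (one_add_pos_of_adj hy (hL.1 u₀)).le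
  -- the unit
  obtain ⟨k₀, hk₀, hr⟩ := exists_nearestDist_eq_dist y (j := i) ⟨τ u₀, hτi u₀⟩
  set r : ℝ := nearestDist y i with hr_def
  have hr0 : 0 < r := by
    rw [hr]
    exact dist_pos.2 fun h => hk₀ (hy h).symm
  have hri : 0 < r⁻¹ := inv_pos.2 hr0
  -- rescaled configuration and the generic facts
  set q : Fin N → E3 := fun j => r⁻¹ • (y j - y i) with hq_def
  have hq_sub : ∀ j l, ‖q j - q l‖ = r⁻¹ * dist (y j) (y l) := by
    intro j l
    simp only [hq_def]
    rw [← smul_sub, sub_sub_sub_cancel_right, norm_smul, Real.norm_of_nonneg hri.le, dist_eq_norm]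
  have hqi : q i = 0 := by simp [hq_def]
  have hq_norm : ∀ j, ‖q j‖ = r⁻¹ * dist (y j) (y i) := by
    intro j
    have := hq_sub j i
    rwa [hqi, sub_zero] at this
  have hq_inj : Function.Injective q := by
    intro j l h
    have h0 : ‖q j - q l‖ = 0 := by rw [h, sub_self, norm_zero]
    rw [hq_sub] at h0
    rcases mul_eq_zero.1 h0 with h1 | h1
    · exact absurd h1 hri.ne'
    · exact hy (dist_eq_zero.1 h1)
  have factA : ∀ j, j ≠ i → 1 ≤ ‖q j‖ := by
    intro j hj
    rw [hq_norm, dist_comm]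
    have := nearestDist_le_dist y hj
    rw [← hr_def] at this
    calc (1 : ℝ) = r⁻¹ * r := by field_simp
      _ ≤ r⁻¹ * dist (y i) (y j) := mul_le_mul_of_nonneg_left this hri.le
  have factR : ∀ j, (bondGraph θ y).Adj i j → ‖q j‖ ≤ 1 + θ := by
    intro j hj
    rw [hq_norm, dist_comm]
    have h1 : dist (y i) (y j) ≤ (1 + θ) * r := dist_le_of_adj hθ hj
    calc r⁻¹ * dist (y i) (y j) ≤ r⁻¹ * ((1 + θ) * r) := mul_le_mul_of_nonneg_left h1 hri.le
      _ = 1 + θ := by field_simp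
  have factB : ∀ j k l, (bondGraph θ y).Adj j k → l ≠ j → ‖q j - q k‖ ≤ (1 + θ) * ‖q j - q l‖ := by
    intro j k l hjk hlj
    rw [hq_sub, hq_sub]
    calc r⁻¹ * dist (y j) (y k) ≤ r⁻¹ * ((1 + θ) * dist (y j) (y l)) :=
          mul_le_mul_of_nonneg_left (dist_le_mul_dist_of_adj hθ hjk hlj) hri.le
      _ = (1 + θ) * (r⁻¹ * dist (y j) (y l)) := by ring
  have factN : ∀ j k j' k', j ≠ k → ¬ (bondGraph θ y).Adj j k → (bondGraph θ y).Adj j j' → (bondGraph θ y).Adj k k' →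
      min ‖q j - q j'‖ ‖q k - q k'‖ < ‖q j - q k‖ := by
    intro j k j' k' hjk hnot hj hk
    rw [hq_sub, hq_sub, hq_sub, ← mul_min_of_nonneg _ _ hri.le]
    exact mul_lt_mul_of_pos_left (min_dist_lt_dist_of_not_adj hθ hjk hnot hj hk) hri
  have factD : ∀ m a, m ≠ i → ¬ (bondGraph θ y).Adj i m → (bondGraph θ y).Adj m a →
      min (1 + θ) ‖q m - q a‖ < ‖q m‖ := by
    intro m a hmi hnot hma
    have hgt : (1 + θ) * min (nearestDist y i) (nearestDist y m) < dist (y i) (y m) := by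
      by_contra hle
      exact hnot (bondGraph_adj.2 ⟨hmi.symm, not_lt.1 hle⟩)
    obtain ⟨-, hle⟩ := bondGraph_adj.1 hma
    have h1 : dist (y m) (y a) ≤ (1 + θ) * nearestDist y m :=
      hle.trans (mul_le_mul_of_nonneg_left (min_le_left _ _) hθ)
    have hmin : min ((1 + θ) * r) (dist (y m) (y a)) < dist (y m) (y i) := by
      rw [mul_min_of_nonneg _ _ hθ, ← hr_def, dist_comm] at hgt
      exact lt_of_le_of_lt (min_le_min le_rfl h1) hgt
    have := mul_lt_mul_of_pos_left hmin hri
    have h2 : r⁻¹ * ((1 + θ) * r) = 1 + θ := by field_simp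
    rw [mul_min_of_nonneg _ _ hri.le, h2] at this
    rw [hq_norm, hq_sub]
    exact this
  -- τ injective
  have hτ : Function.Injective τ := by
    intro u v huv
    by_contra hne
    obtain ⟨w, huw, hvw⟩ := hPat u v hne
    have h1 : (bondGraph θ y).Adj (τ u) (τ w) := (hL.2.2 u w).2 huw
    rw [huv] at h1
    exact hvw ((hL.2.2 v w).1 h1)
  -- the finite data: shell and cap SETS
  set p : ↥Pat → E3 := fun u => q (τ u) with hp_def
  set capSites : ↥Pat → ↥Pat → Set (Fin N) := fun a b =>
    {m | m ≠ i ∧ ∀ w : ↥Pat, (w = a ∨ w = b ∨ (dist (w : E3) (a : E3) = 1 ∧ dist (w : E3) (b : E3) = 1)) →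
      (bondGraph θ y).Adj m (τ w)} with hcapSites
  set C : ↥Pat → ↥Pat → Set E3 := fun a b => q '' capSites a b with hC_def
  have hK : ∀ {x} {j : Fin N}, x ∈ capClusterSet p C → x ≠ q j → ∃ l, l ≠ j ∧ q l = x := by
    intro x j hx hne
    rcases hx with rfl | hx
    · exact ⟨i, fun h => hne (by rw [← h, hqi]), hqi⟩
    rcases hx with ⟨u, rfl⟩ | ⟨a, b, -, hx⟩
    · exact ⟨τ u, fun h => hne (by simp [hp_def, h]), rfl⟩
    · obtain ⟨m, -, rfl⟩ := hx
      exact ⟨m, fun h => hne (by rw [h]), rfl⟩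
  -- a cap candidate is not a shell site and is not bonded to the centre
  have cap_ne : ∀ {a b : ↥Pat} {m : Fin N}, m ∈ capSites a b → ∀ w : ↥Pat, m ≠ τ w := by
    intro a b m hm w heq
    obtain ⟨-, hbond⟩ := hm
    have ha : (bondGraph θ y).Adj m (τ a) := hbond a (Or.inl rfl)
    have hb : (bondGraph θ y).Adj m (τ b) := hbond b (Or.inr (Or.inl rfl))
    rw [heq] at ha hb
    have hw : (bondGraph θ y).Adj m (τ w) := hbond w (Or.inr (Or.inr ⟨(hL.2.2 w a).1 ha, (hL.2.2 w b).1 hb⟩))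
    rw [heq] at hw
    exact hw.ne rfl
  have cap_centre : ∀ {a b : ↥Pat} {m : Fin N}, m ∈ capSites a b → ¬ (bondGraph θ y).Adj i m := by
    intro a b m hm hadj
    obtain ⟨w, hw⟩ := hL.2.1 _ hadj
    exact cap_ne hm w hw.symm
  -- apply the certificate
  obtain ⟨A, hA, hAcap⟩ := hcert p C
    (fun u => ⟨factA _ (hτi u), factR _ (hL.1 u)⟩)
    (hq_inj.comp hτ)
    (by
      intro u x hx hne
      obtain ⟨l, hl, rfl⟩ := hK hx hne
      have := factB (τ u) i l (hL.1 u).symm hl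
      rwa [hqi, sub_zero] at this)
    (by
      intro u v huv x hx hne
      obtain ⟨l, hl, rfl⟩ := hK hx hne
      exact factB (τ u) (τ v) l ((hL.2.2 u v).2 huv) hl)
    (by
      intro u v huv hd
      have hnot : ¬ (bondGraph θ y).Adj (τ u) (τ v) := fun h => hd ((hL.2.2 u v).1 h)
      have := factN (τ u) (τ v) i i (hτ.ne huv) hnot (hL.1 u).symm (hL.1 v).symm
      simpa [hqi] using this)
    (by
      intro a b hab
      obtain ⟨m₀, hm₀i, hm₀⟩ := hC a b hab
      refine ⟨⟨q m₀, m₀, ⟨hm₀i, hm₀⟩, rfl⟩, ?_⟩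
      rintro c ⟨m, hm, rfl⟩
      have hmi : m ≠ i := hm.1
      refine ⟨factA _ hmi, fun w => hq_inj.ne (cap_ne hm w), fun w hw => ⟨?_, ?_, ?_⟩⟩
      · exact factD _ _ hmi (cap_centre hm) (hm.2 w hw)
      · intro x hx hne
        obtain ⟨l, hl, rfl⟩ := hK hx hne
        exact factB _ _ l (hm.2 w hw) hl
      · intro x hx hne
        obtain ⟨l, hl, rfl⟩ := hK hx hne
        have := factB (τ w) m l (hm.2 w hw).symm hl
        rwa [norm_sub_rev (q (τ w)) (q m)] at this)
  -- scale back
  refine ⟨A, fun u => ?_, fun u v m huv hmi hbond => ?_⟩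
  · have hpu : y (τ u) - y i = r • p u := by
      simp only [hp_def, hq_def]
      rw [smul_smul, mul_inv_cancel₀ hr0.ne', one_smul]
    calc ‖(y (τ u) - y i) - nearestDist y i • A (u : E3)‖ = ‖r • (p u - A (u : E3))‖ := by rw [hpu, ← hr_def, smul_sub]
      _ = r * ‖p u - A (u : E3)‖ := by rw [norm_smul, Real.norm_of_nonneg hr0.le]
      _ ≤ r * η₁ := mul_le_mul_of_nonneg_left (hA u) hr0.le
      _ = η₁ * nearestDist y i := by rw [hr_def, mul_comm]
  · have hmem : q m ∈ C u v := ⟨m, ⟨hmi, hbond⟩, rfl⟩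
    have hfit := hAcap u v huv (q m) hmem
    have hqm : y m - y i = r • q m := by
      simp only [hq_def]
      rw [smul_smul, mul_inv_cancel₀ hr0.ne', one_smul]
    calc ‖(y m - y i) - nearestDist y i • A ((u : E3) + (v : E3))‖ = ‖r • (q m - A ((u : E3) + (v : E3)))‖ := by
          rw [hqm, ← hr_def, smul_sub]
      _ = r * ‖q m - A ((u : E3) + (v : E3))‖ := by rw [norm_smul, Real.norm_of_nonneg hr0.le]
      _ ≤ r * η₂ := mul_le_mul_of_nonneg_left hfit hr0.le
      _ = η₂ * nearestDist y i := by rw [hr_def, mul_comm]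

/-- **`M⁺` at both patterns from the two finite two-shell certificates.** [folklore] -/
theorem cappedRigidityBoth_of_certBoth {θ η₁ η₂ : ℝ} (hf : CappedCertBoth θ η₁ η₂ fccKissingPattern)
    (hh : CappedCertBoth θ η₁ η₂ hcpKissingPattern) : CappedRigidityBoth θ η₁ η₂ :=
  ⟨cappedRigidityBothAt_of_certBoth fcc_contactSeparating hf, cappedRigidityBothAt_of_certBoth hcp_contactSeparating hh⟩

end Summit.AtomisticToContinuum.Crystallization.Theorems.FrustratedLawDichotomyCappedCertBoth

end
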